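import Summits.ValiantsHypothesis.ValiantsHypothesis.Theorems.NewtonUnitEquationsTwoProductsPlanarCellBlockMerge

/-!
# Route NewtonUnitEquations — crux `TwoProducts` (stmt-ValiantsHypothesis-5906): the BLOCK LAW for confined coincidences
# (rung R2⁺ / R2 of the registered line `Cruxes/TwoProducts/Lines/relation_ladder.lean`, val-idea-8 g2)

Helper mode (`--supports stmt-ValiantsHypothesis-5906 --as helper`; turnkey packaged by the ideator seat val-idea-8 g2, verbatim the
proofs of the line file @7f45314d68c5; PORTED by the val-lit port pool (val-port-2, director-valiant g11-R114 (b)) in two files by the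
400-line rule — part A `…PlanarCellBlockMerge.lean` = defs `tuples`/`IsCellFamily`/`Confined`/`BlockSmall`/`merge`/`blockSet`/`mergeA`
and the merge lemmas, THIS FILE = part B, the two laws; texts VERBATIM from turnkey sha16 358b6fb35af61235 = tree
`Cruxes/TwoProducts/Lines/relation_ladder_turnkey_BlockLaw.lean`).  Setting of `planarCell_dissociated_linear` (p603804): tails `u, v : Fin m → ℂ[x,y]` with
letters `A j` (`0 ∉ A j`), a weight-order CELL FAMILY `S` of log-visible points.  p603804 needs the letter family to be DISSOCIATED
(`Σ` injective on letter tuples).  Here that hypothesis is relaxed to CONFINEMENT: two letter tuples with the same sum agree OFF a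
position set `J` (`Confined A J`); then, if the block sumset `Σ_{j∈J}(A_j ∪ {0})` lies in `≤ M` points (`BlockSmall A J M`),
**`planarCell_blockLaw`: `#S ≤ 2^{3m}·(M+s+2)^9`** (`#A_j ≤ s`), and **`planarCell_confined`: `|J| ≤ κ ⇒ #S ≤ 2^{3m}(s+2)^{18(κ+1)}`**.
Proof: merge the block into ONE position `j₀ ∈ J` (`merge`; same `m`, no reindexing); confinement makes the merged letter family
`mergeA` dissociated (`injOn_mergeA`); `tailDiff` is unchanged, so strict tops transfer between the two log-supports through
`stub_logLinearisation` (no log additivity is used); the cell is refined over the `≤ M + m s` merged tails by `planarOrder_classes`;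
each class is bounded by `planarCell_dissociated_linear`.
Honest framing: a rung of a crux line; the line's residual (configurations not confined to few positions), `PlanarCellBound`, the
crux `TwoProducts` and `VP ≠ VNP` are OPEN and NOT claimed.  No instances, no notation, no named literature facts. [folklore]
-/

noncomputable section

-- Sub = Summit single-conjunct layout: the duplicated namespace component is mandated by the tree.
set_option linter.dupNamespace false

open scoped BigOperators
open MvPolynomial
open Summit.ValiantsHypothesis.ValiantsHypothesis.Theorems.NewtonUnitEquations.TwoProducts.FormalLogLinearisation

namespace Summit.ValiantsHypothesis.ValiantsHypothesis.Theorems.NewtonUnitEquations.TwoProducts.PlanarCell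

variable {m : ℕ}

/-- **BLOCK LAW (rung R2⁺ of line `relation_ladder`).**  Confined coincidences with a block sumset of `≤ M` points ⇒ every
weight-order cell family of log-visible points has `#S ≤ 2^{3m}·(M+s+2)^9`. [folklore] -/
theorem planarCell_blockLaw (s M : ℕ) (u v : Fin m → MvPolynomial (Fin 2) ℂ) (A : Fin m → Finset Expo) (J : Finset (Fin m))
    (hA0 : ∀ j, (0 : Expo) ∉ A j) (hAs : ∀ j, (A j).card ≤ s) (hu : ∀ j, (u j).support ⊆ A j)
    (hv : ∀ j, (v j).support ⊆ A j) (hconf : Confined A J) (hB : BlockSmall A J M)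
    (R : Expo → Expo → Prop) (S : Finset Expo) (hS : IsCellFamily u v R S) :
    S.card ≤ 2 ^ (3 * m) * (M + s + 2) ^ 9 := by
  classical
  have hS0 : ∀ l ∈ S, ∃ ξ : Fin 2 → ℝ, ValidWeight u v ξ ∧ IsStrictTop ξ (logSupport u v) l ∧
      ∀ e ∈ tailSupport u v, ∀ e' ∈ tailSupport u v, (R e e' ↔ wt ξ e ≤ wt ξ e') := hS
  rcases J.eq_empty_or_nonempty with hJ | ⟨j₀, hj₀⟩
  · subst hJ
    have h := confinedLaw_rung_zero' u v A hA0 hu hv hconf R S hS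
    exact blockLaw_arith m s M 0 S.card (Nat.zero_le _) (by nlinarith [h])
  · have hu0 : ∀ j, coeff 0 (u j) = 0 := fun j => notMem_support_iff.1 fun h => hA0 j (hu j h)
    have hv0 : ∀ j, coeff 0 (v j) = 0 := fun j => notMem_support_iff.1 fun h => hA0 j (hv j h)
    have hu0' : ∀ j, coeff 0 (merge u J j₀ j) = 0 := coeff_zero_merge u J j₀ hu0
    have hv0' : ∀ j, coeff 0 (merge v J j₀ j) = 0 := coeff_zero_merge v J j₀ hv0
    have hA0' : ∀ j, (0 : Expo) ∉ mergeA A J j₀ j := zero_not_mem_mergeA A J j₀ hA0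
    have huA' : ∀ j, (merge u J j₀ j).support ⊆ mergeA A J j₀ j := support_merge_subset u A J j₀ hj₀ hA0 hu
    have hvA' : ∀ j, (merge v J j₀ j).support ⊆ mergeA A J j₀ j := support_merge_subset v A J j₀ hj₀ hA0 hv
    have hdis := injOn_mergeA A J j₀ hj₀ hconf
    have htd : tailDiff (merge u J j₀) (merge v J j₀) = tailDiff u v := tailDiff_merge u v J j₀ hj₀
    have hT'card := card_tailSupport_merge_le u v A J j₀ hj₀ hA0 hu hv M s hAs hB
    set T' := tailSupport (merge u J j₀) (merge v J j₀) with hT'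
    choose! ξ hval htop hRξ using hS0
    have hval' : ∀ l ∈ S, ValidWeight (merge u J j₀) (merge v J j₀) (ξ l) := fun l hl =>
      validWeight_merge u v J j₀ hj₀ hu0 hv0 (hval l hl)
    have htop' : ∀ l ∈ S, IsStrictTop (ξ l) (logSupport (merge u J j₀) (merge v J j₀)) l := by
      intro l hl
      have h1 := (stub_logLinearisation m u v hu0 hv0 (ξ l) (hval l hl) l).2 (htop l hl)
      rw [← htd] at h1
      exact (stub_logLinearisation m _ _ hu0' hv0' (ξ l) (hval' l hl) l).1 h1
    obtain ⟨key, hkey_mem, hkey⟩ := planarOrder_classes T'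
    set Keys := (Finset.univ : Finset (Fin 3 × Fin 3)) ×ˢ
      ((Finset.range (T'.card * T'.card + 1)) ×ˢ (Finset.univ : Finset Bool)) with hKeys
    have hmaps : Set.MapsTo (fun l => key (ξ l)) ↑S ↑Keys := fun l _ => hkey_mem (ξ l)
    have hfib : ∀ k ∈ Keys, (S.filter fun l => key (ξ l) = k).card ≤ 2 * m + 2 := by
      intro k _
      refine planarCell_dissociated_linear (merge u J j₀) (merge v J j₀) (mergeA A J j₀) hA0' huA' hvA' hdis
        (fun e e' => ∀ l ∈ (S.filter fun l => key (ξ l) = k), wt (ξ l) e ≤ wt (ξ l) e')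
        (S.filter fun l => key (ξ l) = k) ?_
      intro l hl
      have hlS : l ∈ S := (Finset.mem_filter.1 hl).1
      have hlk : key (ξ l) = k := (Finset.mem_filter.1 hl).2
      refine ⟨ξ l, hval' l hlS, htop' l hlS, ?_⟩
      intro e he e' he'
      constructor
      · intro h
        exact h l hl
      · intro h l₁ hl₁
        have hk₁ : key (ξ l₁) = k := (Finset.mem_filter.1 hl₁).2
        exact (hkey (ξ l) (ξ l₁) (hlk.trans hk₁.symm) e he e' he').1 h
    have hcard : S.card ≤ Keys.card * (2 * m + 2) := by
      rw [Finset.card_eq_sum_card_fiberwise hmaps]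
      have := Finset.sum_le_card_nsmul Keys _ (2 * m + 2) hfib
      simpa using this
    have hKeys_card : Keys.card = 9 * ((T'.card * T'.card + 1) * 2) := by
      simp [hKeys, Finset.card_product]
    exact blockLaw_arith m s M T'.card S.card hT'card (by rw [← hKeys_card]; exact hcard)

/-- The block sumset of `J` has at most `(s+1)^{|J|}` points. [folklore] -/
theorem blockSmall_of_card (A : Fin m → Finset Expo) (J : Finset (Fin m)) (s : ℕ) (hAs : ∀ j, (A j).card ≤ s) :
    BlockSmall A J ((s + 1) ^ J.card) := by
  classical
  let B : Fin m → Finset Expo := fun j => if j ∈ J then insert (0 : Expo) (A j) else {0}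
  refine ⟨(Fintype.piFinset B).image (fun a => ∑ j ∈ J, a j), ?_, ?_⟩
  · calc ((Fintype.piFinset B).image (fun a => ∑ j ∈ J, a j)).card ≤ (Fintype.piFinset B).card := Finset.card_image_le
      _ = ∏ j, (B j).card := Fintype.card_piFinset B
      _ = ∏ j, (if j ∈ J then (insert (0 : Expo) (A j)).card else 1) := by
          refine Finset.prod_congr rfl fun j _ => ?_
          by_cases hj : j ∈ J <;> simp [B, hj]
      _ = ∏ j ∈ J, (insert (0 : Expo) (A j)).card := by
          rw [Finset.prod_ite_mem, Finset.univ_inter]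
      _ ≤ ∏ j ∈ J, (s + 1) := by
          refine Finset.prod_le_prod' fun j _ => ?_
          exact (Finset.card_insert_le _ _).trans (by simpa using Nat.succ_le_succ (hAs j))
      _ = (s + 1) ^ J.card := Finset.prod_const _
  · intro a ha
    refine Finset.mem_image.2 ⟨fun j => if j ∈ J then a j else 0, ?_, ?_⟩
    · refine Fintype.mem_piFinset.2 fun j => ?_
      by_cases hj : j ∈ J
      · have := Fintype.mem_piFinset.1 ha j
        simpa [B, hj] using this
      · simp [B, hj]
    · exact Finset.sum_congr rfl fun j hj => by simp [hj]

/-- **CONFINED LAW (rung R2 of line `relation_ladder`).**  Coincidences confined to `≤ κ` positions ⇒ per cell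
`#S ≤ 2^{3m}·(s+2)^{18(κ+1)}`. [folklore] -/
theorem planarCell_confined (s κ : ℕ) (u v : Fin m → MvPolynomial (Fin 2) ℂ) (A : Fin m → Finset Expo) (J : Finset (Fin m))
    (hA0 : ∀ j, (0 : Expo) ∉ A j) (hAs : ∀ j, (A j).card ≤ s) (hu : ∀ j, (u j).support ⊆ A j)
    (hv : ∀ j, (v j).support ⊆ A j) (hJ : J.card ≤ κ) (hconf : Confined A J)
    (R : Expo → Expo → Prop) (S : Finset Expo) (hS : IsCellFamily u v R S) :
    S.card ≤ 2 ^ (3 * m) * (s + 2) ^ (2 * 9 * (κ + 1)) := by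
  have key := planarCell_blockLaw s ((s + 1) ^ J.card) u v A J hA0 hAs hu hv hconf (blockSmall_of_card A J s hAs) R S hS
  refine key.trans (Nat.mul_le_mul_left _ ?_)
  have h1 : (s + 1) ^ J.card ≤ (s + 2) ^ (κ + 1) :=
    (Nat.pow_le_pow_left (by omega) _).trans (Nat.pow_le_pow_right (by omega) (by omega))
  have hs : s + 2 ≤ (s + 2) ^ (κ + 1) := Nat.le_self_pow (by omega) _
  have hX : 2 ≤ (s + 2) ^ (κ + 1) := le_trans (by omega) hs
  have h2 : (s + 1) ^ J.card + s + 2 ≤ (s + 2) ^ (κ + 1) * (s + 2) ^ (κ + 1) := by nlinarith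
  have h3 : (s + 2) ^ (κ + 1) * (s + 2) ^ (κ + 1) = (s + 2) ^ (2 * (κ + 1)) := by rw [← pow_add]; ring_nf
  calc ((s + 1) ^ J.card + s + 2) ^ 9 ≤ ((s + 2) ^ (2 * (κ + 1))) ^ 9 :=
        Nat.pow_le_pow_left (h2.trans_eq h3) _
    _ = (s + 2) ^ (2 * 9 * (κ + 1)) := by rw [← pow_mul]; ring_nf

end Summit.ValiantsHypothesis.ValiantsHypothesis.Theorems.NewtonUnitEquations.TwoProducts.PlanarCell

end
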